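import Literature.MathematicalPhysics.QuantumLattice.YangMillsHeatFlowHeatType
import HarnessLib

/-!
# Evolution of `∇²_A F` under the Yang–Mills heat flow and the Bochner inequality for `|∇²F|²`

QuantumLattice support file (everything proved; no definitions, no named facts) on the proof
path of `Literature.MathematicalPhysics.QuantumLattice.Waldron2019_yangMillsFlow_flatTorus`
(A. Waldron, Invent. math. 217 (2019)), §3: the `k = 2` derivative estimate of the
`ε`-regularity Proposition 3.1(a) (after [instantons] Lemma 3.1). Flat space, frame form.

* `contDiffOn_covDeriv_curvature_joint'` — joint smoothness of `(t, y) ↦ D_wF(t)(u,v)(y)`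
  (general normed-algebra coefficients);
* `covDeriv_gradSource_eq` — `D_a` of the source `Ψ₁ = 2∑ᵢ([F_{wi}, DᵢF_{uv}] + [D_wF_{ui}, F_{iv}]
  + [F_{ui}, D_wF_{iv}])` of the evolution of `D_wF_{uv}` (covariant Leibniz rule);
* `hasDerivAt_covDeriv_covDeriv_curvature_of_flow` — **evolution of `∇²F`**:
  `∂ₜ(D_aD_wF_{uv}) = ∑ᵢDᵢDᵢ(D_aD_wF_{uv}) + D_aΨ₁ + 2∑ᵢ[F_{ai}, DᵢD_wF_{uv}]`
  (`hasDerivAt_covDeriv_of_heatType`);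
* `deriv_hessDensity_sub_laplacian_le` — **Bochner inequality** for
  `P = ∑_{awuv}‖D_aD_wF(b_u,b_v)‖²`: for every `θ > 0`,
`∂ₜP − ∑ₗ∂ₗ∂ₗP ≤ −2∑‖DₗD_aD_wF‖² + (16√2 c(1+c⁴) √e + 12 c θ) P + (12c⁵/θ) N²` (`c = card ι`,
  `N = ∑‖DᵢF_{jk}‖²`) — linear in `P` with the lower-order source `N²` once `|F|` is bounded
  (crude counting of the `∇²F # F` and `∇F # ∇F` terms; the constants are immaterial).

References: A. Waldron, Invent. math. 217 (2019), Prop. 3.1(a) [Waldron2019]; A. Waldron,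
Calc. Var. PDE 55 (2016), Lemma 3.1 [Waldron2016].
-/

noncomputable section

open scoped ContDiff Topology RealInnerProductSpace Matrix
open Set Filter

namespace Literature.MathematicalPhysics.QuantumLattice

/-! ### The evolution of `∇²F` under the flow -/

section HessEvolution

variable {E : Type*} [NormedAddCommGroup E] [InnerProductSpace ℝ E] [FiniteDimensional ℝ E]
variable {𝔸 : Type*} [NormedRing 𝔸] [NormedAlgebra ℝ 𝔸]
variable {ι : Type*} [Fintype ι]

/-- Finite differentiability orders are below `∞`. [folklore] -/
private theorem natCast_le_infty₁₄ (n : ℕ) : (n : WithTop ℕ∞) ≤ (⊤ : ℕ∞) := by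
  exact_mod_cast le_top

omit [Fintype ι] [FiniteDimensional ℝ E] in
/-- **Joint smoothness of `(t, y) ↦ D_w F(t)(u, v)(y)`** on an open time set (general
normed-algebra coefficients; cf. `contDiffOn_covDeriv_curvature_joint`). [folklore] -/
theorem contDiffOn_covDeriv_curvature_joint' {A : ℝ → Connection E 𝔸} {𝒯 : Set ℝ}
    (h𝒯 : IsOpen 𝒯) (hA : ContDiffOn ℝ ∞ (fun p : ℝ × E => A p.1 p.2) (𝒯 ×ˢ (univ : Set E)))
    (u v w : E) :
    ContDiffOn ℝ ∞ (fun p : ℝ × E =>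
      covDeriv (A p.1) (fun z => curvature (A p.1) z u v) p.2 w) (𝒯 ×ˢ (univ : Set E)) := by
  have hU : IsOpen (𝒯 ×ˢ (univ : Set E)) := h𝒯.prod isOpen_univ
  have hΦ : ContDiffOn ℝ ∞ (fun p : ℝ × E => curvature (A p.1) p.2 u v) (𝒯 ×ˢ (univ : Set E)) :=
    contDiffOn_curvature_joint hU hA (m := ∞) (by norm_cast) u v
  have hΦ' : ContDiffOn ℝ ∞ (fun p : ℝ × E =>
      fderiv ℝ (fun p : ℝ × E => curvature (A p.1) p.2 u v) p ((0 : ℝ), w))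
      (𝒯 ×ˢ (univ : Set E)) :=
    ((hΦ.fderiv_of_isOpen hU (m := ∞) (by norm_cast)).clm_apply contDiffOn_const)
  have hAw : ContDiffOn ℝ ∞ (fun p : ℝ × E => A p.1 p.2 w) (𝒯 ×ˢ (univ : Set E)) :=
    hA.clm_apply contDiffOn_const
  have hbr : ContDiffOn ℝ ∞ (fun p : ℝ × E => ⁅A p.1 p.2 w, curvature (A p.1) p.2 u v⁆)
      (𝒯 ×ˢ (univ : Set E)) := by
    have h := (hAw.mul hΦ).sub (hΦ.mul hAw)
    simp only [Ring.lie_def]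
    exact h
  refine (hΦ'.add hbr).congr fun p hp => ?_
  obtain ⟨t, y⟩ := p
  change covDeriv (A t) (fun z => curvature (A t) z u v) y w = _
  unfold covDeriv
  rw [fderiv_spaceSlice_apply hU hΦ (by simp) hp w]

omit [FiniteDimensional ℝ E] in
/-- **`D_a` of the source term of the evolution of `∇F`** (covariant Leibniz rule): for a `C³`
connection `A` with curvature `F`, writing `Fᵢ(y) = F(y)(·,·)` and `D` for `covDeriv`,
`D_a (2∑ᵢ([F_{wi}, DᵢF_{uv}] + [D_wF_{ui}, F_{iv}] + [F_{ui}, D_wF_{iv}]))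
 = 2∑ᵢ([D_aF_{wi}, DᵢF_{uv}] + [F_{wi}, D_aDᵢF_{uv}] + [D_aD_wF_{ui}, F_{iv}] + [D_wF_{ui}, D_aF_{iv}]
   + [D_aF_{ui}, D_wF_{iv}] + [F_{ui}, D_aD_wF_{iv}])`. [folklore] -/
theorem covDeriv_gradSource_eq (b : OrthonormalBasis ι ℝ E) (A : Connection E 𝔸)
    (hA : ContDiff ℝ 3 A) (x u v w a : E) :
    covDeriv A (fun y => (2 : ℝ) • ∑ i, (⁅curvature A y w (b i),
        covDeriv A (fun z => curvature A z u v) y (b i)⁆ +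
      ⁅covDeriv A (fun z => curvature A z u (b i)) y w, curvature A y (b i) v⁆ +
      ⁅curvature A y u (b i), covDeriv A (fun z => curvature A z (b i) v) y w⁆)) x a =
    (2 : ℝ) • ∑ i,
      (⁅covDeriv A (fun z => curvature A z w (b i)) x a,
          covDeriv A (fun z => curvature A z u v) x (b i)⁆ +
        ⁅curvature A x w (b i), covDeriv A (fun y => covDeriv A
          (fun z => curvature A z u v) y (b i)) x a⁆ +
      (⁅covDeriv A (fun y => covDeriv A (fun z => curvature A z u (b i)) y w) x a,
          curvature A x (b i) v⁆ +
        ⁅covDeriv A (fun z => curvature A z u (b i)) x w,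
          covDeriv A (fun z => curvature A z (b i) v) x a⁆) +
      (⁅covDeriv A (fun z => curvature A z u (b i)) x a,
          covDeriv A (fun z => curvature A z (b i) v) x w⁆ +
        ⁅curvature A x u (b i), covDeriv A (fun y => covDeriv A
          (fun z => curvature A z (b i) v) y w) x a⁆)) := by
  have hA21 : ContDiff ℝ (2 + 1) A := by rw [show (2 : WithTop ℕ∞) + 1 = 3 by norm_num]; exact hA
  have hA12 : ContDiff ℝ (1 + 2) A := by rw [show (1 : WithTop ℕ∞) + 2 = 3 by norm_num]; exact hA
  have hFd : ∀ c d y, DifferentiableAt ℝ (fun z => curvature A z c d) y := fun c d y =>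
    ((contDiff_curvature_apply hA21 c d).differentiable two_ne_zero) y
  have hDFd : ∀ c d d' y, DifferentiableAt ℝ
      (fun z => covDeriv A (fun z' => curvature A z' c d) z d') y := fun c d d' y =>
    ((contDiff_covDeriv_curvature_apply (k := 1) hA12 c d d').differentiable one_ne_zero) y
  have hlie : ∀ {φ ψ : E → 𝔸} {y : E}, DifferentiableAt ℝ φ y → DifferentiableAt ℝ ψ y →
      DifferentiableAt ℝ (fun y => ⁅φ y, ψ y⁆) y := by
    intro φ ψ y hφ hψ
    have heq : (fun y => ⁅φ y, ψ y⁆) = fun y => φ y * ψ y - ψ y * φ y :=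
      funext fun y => Ring.lie_def _ _
    rw [heq]; exact (hφ.mul hψ).sub (hψ.mul hφ)
  have h1 : ∀ i y, DifferentiableAt ℝ (fun y => ⁅curvature A y w (b i),
      covDeriv A (fun z => curvature A z u v) y (b i)⁆) y := fun i y =>
    hlie (hFd w (b i) y) (hDFd u v (b i) y)
  have h2 : ∀ i y, DifferentiableAt ℝ (fun y =>
      ⁅covDeriv A (fun z => curvature A z u (b i)) y w, curvature A y (b i) v⁆) y := fun i y =>
    hlie (hDFd u (b i) w y) (hFd (b i) v y)
  have h3 : ∀ i y, DifferentiableAt ℝ (fun y =>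
      ⁅curvature A y u (b i), covDeriv A (fun z => curvature A z (b i) v) y w⁆) y := fun i y =>
    hlie (hFd u (b i) y) (hDFd (b i) v w y)
  have h123 : ∀ i y, DifferentiableAt ℝ (fun y => ⁅curvature A y w (b i),
        covDeriv A (fun z => curvature A z u v) y (b i)⁆ +
      ⁅covDeriv A (fun z => curvature A z u (b i)) y w, curvature A y (b i) v⁆ +
      ⁅curvature A y u (b i), covDeriv A (fun z => curvature A z (b i) v) y w⁆) y := fun i y =>
    ((h1 i y).add (h2 i y)).add (h3 i y)
  rw [covDeriv_fun_smul A 2 (DifferentiableAt.fun_sum fun i _ => h123 i x) a,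
    covDeriv_fun_sum Finset.univ A (fun i _ => h123 i x) a]
  congr 1
  refine Finset.sum_congr rfl fun i _ => ?_
  have h12 : DifferentiableAt ℝ (fun y => ⁅curvature A y w (b i),
        covDeriv A (fun z => curvature A z u v) y (b i)⁆ +
      ⁅covDeriv A (fun z => curvature A z u (b i)) y w, curvature A y (b i) v⁆) x :=
    (h1 i x).add (h2 i x)
  rw [covDeriv_fun_add A h12 (h3 i x) a,
    covDeriv_fun_add A (h1 i x) (h2 i x) a,
    covDeriv_lie_apply A (hFd w (b i) x) (hDFd u v (b i) x) a,
    covDeriv_lie_apply A (hDFd u (b i) w x) (hFd (b i) v x) a,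
    covDeriv_lie_apply A (hFd u (b i) x) (hDFd (b i) v w x) a]

/-- **Evolution of the second covariant derivatives of the curvature under the Yang–Mills heat
flow** (flat space; `k = 2`). Let `A` be jointly smooth on `𝒯 × E` (`𝒯` open) and solve
`∂ₜA = div_A F_A` on `𝒯`. Then for `t ∈ 𝒯`, every `x`, vectors `u v w a` and an orthonormal frame,
`∂ₜ(D_aD_wF_{uv}) = ∑ᵢ DᵢDᵢ(D_aD_wF_{uv}) + D_aΨ₁ + 2∑ᵢ[F_{ai}, DᵢD_wF_{uv}]` with
`Ψ₁ = 2∑ᵢ([F_{wi}, DᵢF_{uv}] + [D_wF_{ui}, F_{iv}] + [F_{ui}, D_wF_{iv}])` the source of the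
evolution of `D_wF_{uv}` (`hasDerivAt_covDeriv_curvature_of_flow`), by
`hasDerivAt_covDeriv_of_heatType`. [cite: Waldron2016, Lemma 3.1 (k = 2); Waldron2019, Prop. 3.1(a)] -/
theorem hasDerivAt_covDeriv_covDeriv_curvature_of_flow (b : OrthonormalBasis ι ℝ E)
    {A : ℝ → Connection E 𝔸} {𝒯 : Set ℝ} (h𝒯 : IsOpen 𝒯)
    (hA : ContDiffOn ℝ ∞ (fun p : ℝ × E => A p.1 p.2) (𝒯 ×ˢ (univ : Set E)))
    (hpde : ∀ ⦃s : ℝ⦄, s ∈ 𝒯 → ∀ y w, deriv (fun s' => A s' y w) s = divCurvature (A s) y w)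
    {t : ℝ} (ht : t ∈ 𝒯) (x u v w a : E) :
    HasDerivAt (fun s => covDeriv (A s) (fun y => covDeriv (A s)
        (fun z => curvature (A s) z u v) y w) x a)
      (∑ i, covDeriv (A t) (fun y => covDeriv (A t) (fun y' => covDeriv (A t)
          (fun y'' => covDeriv (A t) (fun z => curvature (A t) z u v) y'' w) y' a) y (b i)) x (b i) +
        (covDeriv (A t) (fun y => (2 : ℝ) • ∑ i, (⁅curvature (A t) y w (b i),
            covDeriv (A t) (fun z => curvature (A t) z u v) y (b i)⁆ +
          ⁅covDeriv (A t) (fun z => curvature (A t) z u (b i)) y w, curvature (A t) y (b i) v⁆ +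
          ⁅curvature (A t) y u (b i), covDeriv (A t) (fun z => curvature (A t) z (b i) v) y w⁆)) x a +
          (2 : ℝ) • ∑ i, ⁅curvature (A t) x a (b i), covDeriv (A t) (fun y => covDeriv (A t)
            (fun z => curvature (A t) z u v) y w) x (b i)⁆)) t := by
  have hsm : ContDiff ℝ ∞ (A t) := contDiff_slice_of_contDiffOn_prod hA ht
  have hA3 : ContDiff ℝ 3 (A t) := hsm.of_le (natCast_le_infty₁₄ 3)
  have hA21 : ContDiff ℝ (2 + 1) (A t) := by
    rw [show (2 : WithTop ℕ∞) + 1 = 3 by norm_num]; exact hA3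
  have hA12 : ContDiff ℝ (1 + 2) (A t) := by
    rw [show (1 : WithTop ℕ∞) + 2 = 3 by norm_num]; exact hA3
  have hFd : ∀ c d, Differentiable ℝ (fun z => curvature (A t) z c d) := fun c d =>
    (contDiff_curvature_apply hA21 c d).differentiable two_ne_zero
  have hDFd : ∀ c d d', Differentiable ℝ
      (fun z => covDeriv (A t) (fun z' => curvature (A t) z' c d) z d') := fun c d d' =>
    (contDiff_covDeriv_curvature_apply (k := 1) hA12 c d d').differentiable one_ne_zero
  have hlie : ∀ {φ ψ : E → 𝔸}, Differentiable ℝ φ → Differentiable ℝ ψ →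
      Differentiable ℝ (fun y => ⁅φ y, ψ y⁆) := by
    intro φ ψ hφ hψ
    have heq : (fun y => ⁅φ y, ψ y⁆) = fun y => φ y * ψ y - ψ y * φ y :=
      funext fun y => Ring.lie_def _ _
    rw [heq]; exact (hφ.mul hψ).sub (hψ.mul hφ)
  have hΨ : Differentiable ℝ (fun y => (2 : ℝ) • ∑ i, (⁅curvature (A t) y w (b i),
        covDeriv (A t) (fun z => curvature (A t) z u v) y (b i)⁆ +
      ⁅covDeriv (A t) (fun z => curvature (A t) z u (b i)) y w, curvature (A t) y (b i) v⁆ +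
      ⁅curvature (A t) y u (b i), covDeriv (A t) (fun z => curvature (A t) z (b i) v) y w⁆)) := by
    refine (Differentiable.fun_sum fun i _ => ?_).const_smul (2 : ℝ)
    exact ((hlie (hFd w (b i)) (hDFd u v (b i))).add (hlie (hDFd u (b i) w) (hFd (b i) v))).add
      (hlie (hFd u (b i)) (hDFd (b i) v w))
  exact hasDerivAt_covDeriv_of_heatType b h𝒯 hA hpde ht
    (Φ := fun s y => covDeriv (A s) (fun z => curvature (A s) z u v) y w)
    (contDiffOn_covDeriv_curvature_joint' h𝒯 hA u v w) hΨ
    (fun y => hasDerivAt_covDeriv_curvature_of_flow b h𝒯 hA hpde ht y u v w) x a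

end HessEvolution

/-! ### The Bochner inequality for `|∇²F|²` -/

section HessBochner

open scoped Matrix.Norms.Frobenius

attribute [local instance] frobeniusInnerProductSpace

variable {m : Type*} [Fintype m] [DecidableEq m]
variable {E : Type*} [NormedAddCommGroup E] [InnerProductSpace ℝ E] [FiniteDimensional ℝ E]
variable {ι : Type*} [Fintype ι] [LinearOrder ι]

omit [LinearOrder ι] in
/-- A single term of a fourfold sum of nonnegative reals is bounded by the sum. [folklore] -/
private theorem le_sum4 {g : ι → ι → ι → ι → ℝ} (hg : ∀ a w u v, 0 ≤ g a w u v) (a w u v : ι) :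
    g a w u v ≤ ∑ a', ∑ w', ∑ u', ∑ v', g a' w' u' v' := by
  have h1 : g a w u v ≤ ∑ v', g a w u v' :=
    Finset.single_le_sum (f := fun v' => g a w u v') (fun v' _ => hg a w u v') (Finset.mem_univ v)
  have h2 : ∑ v', g a w u v' ≤ ∑ u', ∑ v', g a w u' v' :=
    Finset.single_le_sum (f := fun u' => ∑ v', g a w u' v')
      (fun u' _ => Finset.sum_nonneg fun v' _ => hg a w u' v') (Finset.mem_univ u)
  have h3 : ∑ u', ∑ v', g a w u' v' ≤ ∑ w', ∑ u', ∑ v', g a w' u' v' :=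
    Finset.single_le_sum (f := fun w' => ∑ u', ∑ v', g a w' u' v')
      (fun w' _ => Finset.sum_nonneg fun u' _ => Finset.sum_nonneg fun v' _ => hg a w' u' v')
      (Finset.mem_univ w)
  have h4 : ∑ w', ∑ u', ∑ v', g a w' u' v' ≤ ∑ a', ∑ w', ∑ u', ∑ v', g a' w' u' v' :=
    Finset.single_le_sum (f := fun a' => ∑ w', ∑ u', ∑ v', g a' w' u' v')
      (fun a' _ => Finset.sum_nonneg fun w' _ => Finset.sum_nonneg fun u' _ =>
        Finset.sum_nonneg fun v' _ => hg a' w' u' v') (Finset.mem_univ a)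
  exact h1.trans (h2.trans (h3.trans h4))

omit [LinearOrder ι] in
/-- A single term of a threefold sum of nonnegative reals is bounded by the sum. [folklore] -/
private theorem le_sum3 {g : ι → ι → ι → ℝ} (hg : ∀ a u v, 0 ≤ g a u v) (a u v : ι) :
    g a u v ≤ ∑ a', ∑ u', ∑ v', g a' u' v' := by
  have h1 : g a u v ≤ ∑ v', g a u v' :=
    Finset.single_le_sum (f := fun v' => g a u v') (fun v' _ => hg a u v') (Finset.mem_univ v)
  have h2 : ∑ v', g a u v' ≤ ∑ u', ∑ v', g a u' v' :=
    Finset.single_le_sum (f := fun u' => ∑ v', g a u' v')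
      (fun u' _ => Finset.sum_nonneg fun v' _ => hg a u' v') (Finset.mem_univ u)
  have h3 : ∑ u', ∑ v', g a u' v' ≤ ∑ a', ∑ u', ∑ v', g a' u' v' :=
    Finset.single_le_sum (f := fun a' => ∑ u', ∑ v', g a' u' v')
      (fun a' _ => Finset.sum_nonneg fun u' _ => Finset.sum_nonneg fun v' _ => hg a' u' v')
      (Finset.mem_univ a)
  exact h1.trans (h2.trans h3)

/-- Weighted arithmetic–geometric mean: `2xy ≤ θx² + y²/θ` for `θ > 0`. [folklore] -/
private theorem two_mul_le_weighted' {θ : ℝ} (hθ : 0 < θ) (x y : ℝ) :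
    2 * x * y ≤ θ * x ^ 2 + y ^ 2 / θ := by
  have h : 0 ≤ (θ * x - y) ^ 2 / θ := div_nonneg (sq_nonneg _) hθ.le
  have e : (θ * x - y) ^ 2 / θ = θ * x ^ 2 + y ^ 2 / θ - 2 * x * y := by
    field_simp; ring
  linarith [h, e]

set_option maxHeartbeats 4000000 in
-- (a long bookkeeping proof over five indices)
/-- **The Bochner inequality for `|∇²F|²` along the Yang–Mills heat flow** (flat space; `k = 2`).
For a jointly smooth `𝔲(m)`-valued solution on an open time set `𝒯 ∋ t`, an orthonormal frame
`b` and every `θ > 0`, with `P = ∑_{awuv}‖D_{b_a}D_{b_w}F(b_u,b_v)‖²`, `N = ∑_{ijk}‖DᵢF_{jk}‖²`,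
`e = ymDensityOfBasis b`, `c = card ι`:
`∂ₜP − ∑ₗ∂ₗ∂ₗP ≤ −2∑‖DₗD_aD_wF_{uv}‖² + (16√2 c (1 + c⁴) √e + 12 c θ) P + (12 c⁵/θ) N²`.
[cite: Waldron2016, Lemma 3.1 (k = 2); Waldron2019, Prop. 3.1(a)] -/
theorem deriv_hessDensity_sub_laplacian_le (b : OrthonormalBasis ι ℝ E)
    {A : ℝ → Connection E (Matrix m m ℂ)} {𝒯 : Set ℝ} (h𝒯 : IsOpen 𝒯)
    (hA : ContDiffOn ℝ ∞ (fun p : ℝ × E => A p.1 p.2) (𝒯 ×ˢ (univ : Set E)))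
    (hval : ∀ ⦃s : ℝ⦄, s ∈ 𝒯 → (A s).IsValuedIn (skewAdjoint.submodule ℝ (Matrix m m ℂ)))
    (hpde : ∀ ⦃s : ℝ⦄, s ∈ 𝒯 → ∀ y w, deriv (fun s' => A s' y w) s = divCurvature (A s) y w)
    {t : ℝ} (ht : t ∈ 𝒯) (x : E) {θ : ℝ} (hθ : 0 < θ) :
    deriv (fun s => ∑ a, ∑ w, ∑ u, ∑ v, ‖covDeriv (A s) (fun y => covDeriv (A s)
        (fun z => curvature (A s) z (b u) (b v)) y (b w)) x (b a)‖ ^ 2) t -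
        ∑ l, fderiv ℝ (fun y => fderiv ℝ (fun z => ∑ a, ∑ w, ∑ u, ∑ v,
          ‖covDeriv (A t) (fun y' => covDeriv (A t) (fun z' => curvature (A t) z' (b u) (b v)) y'
            (b w)) z (b a)‖ ^ 2) y (b l)) x (b l) ≤
      -(2 * ∑ l, ∑ a, ∑ w, ∑ u, ∑ v, ‖covDeriv (A t) (fun y => covDeriv (A t)
          (fun y' => covDeriv (A t) (fun z => curvature (A t) z (b u) (b v)) y' (b w)) y (b a))
          x (b l)‖ ^ 2) +
        (16 * Real.sqrt 2 * (Fintype.card ι : ℝ) * (1 + (Fintype.card ι : ℝ) ^ 4) *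
            Real.sqrt (ymDensityOfBasis b (A t) x) + 12 * (Fintype.card ι : ℝ) * θ) *
          ∑ a, ∑ w, ∑ u, ∑ v, ‖covDeriv (A t) (fun y => covDeriv (A t)
            (fun z => curvature (A t) z (b u) (b v)) y (b w)) x (b a)‖ ^ 2 +
        12 * (Fintype.card ι : ℝ) ^ 5 / θ *
          (∑ i, ∑ j, ∑ k, ‖covDeriv (A t) (fun z => curvature (A t) z (b j) (b k)) x (b i)‖ ^ 2) ^ 2 := by
  have hsm : ContDiff ℝ ∞ (A t) := contDiff_slice_of_contDiffOn_prod hA ht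
  have hA1 : ContDiff ℝ 1 (A t) := hsm.of_le (natCast_le_infty₁₄ 1)
  have hA3 : ContDiff ℝ 3 (A t) := hsm.of_le (natCast_le_infty₁₄ 3)
  have hA22 : ContDiff ℝ (2 + 2) (A t) := by
    rw [show (2 : WithTop ℕ∞) + 2 = 4 by norm_num]; exact hsm.of_le (natCast_le_infty₁₄ 4)
  -- ### notation
  set F : ι → ι → Matrix m m ℂ := fun j k => curvature (A t) x (b j) (b k) with hF
  set DF : ι → ι → ι → Matrix m m ℂ := fun a j k =>
    covDeriv (A t) (fun z => curvature (A t) z (b j) (b k)) x (b a) with hDF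
  set Gf : ι → ι → ι → ι → E → Matrix m m ℂ := fun a w u v y =>
    covDeriv (A t) (fun y' => covDeriv (A t) (fun z => curvature (A t) z (b u) (b v)) y' (b w)) y
      (b a) with hGf
  set G : ι → ι → ι → ι → Matrix m m ℂ := fun a w u v => Gf a w u v x with hG
  have hGf2 : ∀ a w u v, ContDiff ℝ 2 (Gf a w u v) := fun a w u v => by
    have h2 : ContDiff ℝ (1 + 1) (fun y' => covDeriv (A t)
        (fun z => curvature (A t) z (b u) (b v)) y' (b w)) := by
      rw [show (1 : WithTop ℕ∞) + 1 = 2 by norm_num]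
      exact contDiff_covDeriv_curvature_apply (k := 2) hA22 (b u) (b v) (b w)
    have h3 : ContDiff ℝ (2 + 1) (fun y' => covDeriv (A t)
        (fun z => curvature (A t) z (b u) (b v)) y' (b w)) := by
      rw [show (2 : WithTop ℕ∞) + 1 = 3 by norm_num]
      have hA23 : ContDiff ℝ (3 + 2) (A t) := by
        rw [show (3 : WithTop ℕ∞) + 2 = 5 by norm_num]; exact hsm.of_le (natCast_le_infty₁₄ 5)
      exact contDiff_covDeriv_curvature_apply (k := 3) hA23 (b u) (b v) (b w)
    exact contDiff_covDeriv_apply (hsm.of_le (natCast_le_infty₁₄ 2)) h3 (b a)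
  -- the sources
  set Ψ₁ : ι → ι → ι → E → Matrix m m ℂ := fun w u v y => (2 : ℝ) • ∑ i,
    (⁅curvature (A t) y (b w) (b i), covDeriv (A t) (fun z => curvature (A t) z (b u) (b v)) y (b i)⁆ +
      ⁅covDeriv (A t) (fun z => curvature (A t) z (b u) (b i)) y (b w), curvature (A t) y (b i) (b v)⁆ +
      ⁅curvature (A t) y (b u) (b i), covDeriv (A t) (fun z => curvature (A t) z (b i) (b v)) y (b w)⁆)
    with hΨ₁
  set Ψ : ι × ι × ι × ι → Matrix m m ℂ := fun p =>
    covDeriv (A t) (Ψ₁ p.2.1 p.2.2.1 p.2.2.2) x (b p.1) +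
      (2 : ℝ) • ∑ i, ⁅F p.1 i, Gf i p.2.1 p.2.2.1 p.2.2.2 x⁆ with hΨ
  -- ### the Bochner identity for the family `G`
  set Gs : ι × ι × ι × ι → ℝ → E → Matrix m m ℂ := fun p s y => covDeriv (A s)
    (fun y' => covDeriv (A s) (fun z => curvature (A s) z (b p.2.2.1) (b p.2.2.2)) y' (b p.2.1)) y
      (b p.1) with hGs
  have hev : ∀ p : ι × ι × ι × ι, HasDerivAt (fun s => Gs p s x)
      (∑ i, covDeriv (A t) (fun y => covDeriv (A t) (Gs p t) y (b i)) x (b i) + Ψ p) t := fun p =>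
    hasDerivAt_covDeriv_covDeriv_curvature_of_flow b h𝒯 hA hpde ht x (b p.2.2.1) (b p.2.2.2)
      (b p.2.1) (b p.1)
  have hGp : ∀ p : ι × ι × ι × ι, ContDiff ℝ 2 (Gs p t) := fun p => hGf2 p.1 p.2.1 p.2.2.1 p.2.2.2
  have hB := deriv_sum_norm_sq_sub_laplacian_eq_of_heatType (κ := ι × ι × ι × ι) b hA1 (hval ht)
    (G := Gs) (Ψ := Ψ) hGp x hev
  simp only [Fintype.sum_prod_type] at hB
  rw [hB]
  -- ### the source bound
  set ee : ℝ := ymDensityOfBasis b (A t) x with hee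
  set P : ℝ := ∑ a, ∑ w, ∑ u, ∑ v, ‖G a w u v‖ ^ 2 with hP
  set N : ℝ := ∑ i, ∑ j, ∑ k, ‖DF i j k‖ ^ 2 with hN
  have hFle : ∀ j k, ‖F j k‖ ≤ Real.sqrt (2 * ee) := fun j k =>
    norm_curvature_apply_le_sqrt b (A t) x j k
  set c₀ : ℝ := 2 * Real.sqrt (2 * ee) with hc₀
  have hc₀0 : 0 ≤ c₀ := by positivity
  have hP0 : 0 ≤ P := Finset.sum_nonneg fun _ _ => Finset.sum_nonneg fun _ _ =>
    Finset.sum_nonneg fun _ _ => Finset.sum_nonneg fun _ _ => sq_nonneg _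
  have hN0 : 0 ≤ N := Finset.sum_nonneg fun _ _ => Finset.sum_nonneg fun _ _ =>
    Finset.sum_nonneg fun _ _ => sq_nonneg _
  have hGle : ∀ a w u v, ‖G a w u v‖ ^ 2 ≤ P := fun a w u v =>
    le_sum4 (g := fun a w u v => ‖G a w u v‖ ^ 2) (fun _ _ _ _ => sq_nonneg _) a w u v
  have hDFle : ∀ a j k, ‖DF a j k‖ ^ 2 ≤ N := fun a j k =>
    le_sum3 (g := fun a j k => ‖DF a j k‖ ^ 2) (fun _ _ _ => sq_nonneg _) a j k
  -- brackets with a curvature factor: `≤ c₀ ‖X‖ ‖Y‖ ≤ c₀ (‖X‖² + P)/2` when `‖Y‖² ≤ P`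
  have hbrF : ∀ (X Y : Matrix m m ℂ) (j k : ι), ‖Y‖ ^ 2 ≤ P →
      ⟪X, ⁅F j k, Y⁆⟫ ≤ c₀ * ((‖X‖ ^ 2 + P) / 2) := by
    intro X Y j k hY
    have h1 : ⟪X, ⁅F j k, Y⁆⟫ ≤ c₀ * (‖X‖ * ‖Y‖) :=
      calc ⟪X, ⁅F j k, Y⁆⟫ ≤ |⟪X, ⁅F j k, Y⁆⟫| := le_abs_self _
        _ ≤ 2 * ‖X‖ * ‖F j k‖ * ‖Y‖ := abs_frobenius_inner_lie_le _ _ _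
        _ ≤ 2 * ‖X‖ * Real.sqrt (2 * ee) * ‖Y‖ := by gcongr; exact hFle j k
        _ = c₀ * (‖X‖ * ‖Y‖) := by rw [hc₀]; ring
    have h2 : ‖X‖ * ‖Y‖ ≤ (‖X‖ ^ 2 + P) / 2 := by
      nlinarith [sq_nonneg (‖X‖ - ‖Y‖), hY, norm_nonneg X, norm_nonneg Y]
    exact h1.trans (mul_le_mul_of_nonneg_left h2 hc₀0)
  have hbrF' : ∀ (X Y : Matrix m m ℂ) (j k : ι), ‖Y‖ ^ 2 ≤ P →
      ⟪X, ⁅Y, F j k⁆⟫ ≤ c₀ * ((‖X‖ ^ 2 + P) / 2) := by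
    intro X Y j k hY
    have h1 : ⟪X, ⁅Y, F j k⁆⟫ ≤ c₀ * (‖X‖ * ‖Y‖) :=
      calc ⟪X, ⁅Y, F j k⁆⟫ ≤ |⟪X, ⁅Y, F j k⁆⟫| := le_abs_self _
        _ ≤ 2 * ‖X‖ * ‖Y‖ * ‖F j k‖ := abs_frobenius_inner_lie_le _ _ _
        _ ≤ 2 * ‖X‖ * ‖Y‖ * Real.sqrt (2 * ee) := by gcongr; exact hFle j k
        _ = c₀ * (‖X‖ * ‖Y‖) := by rw [hc₀]; ring
    have h2 : ‖X‖ * ‖Y‖ ≤ (‖X‖ ^ 2 + P) / 2 := by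
      nlinarith [sq_nonneg (‖X‖ - ‖Y‖), hY, norm_nonneg X, norm_nonneg Y]
    exact h1.trans (mul_le_mul_of_nonneg_left h2 hc₀0)
  -- brackets of two `∇F` factors: `≤ θ‖X‖² + N²/θ`
  have hbrD : ∀ (X : Matrix m m ℂ) (a j k a' j' k' : ι),
      ⟪X, ⁅DF a j k, DF a' j' k'⁆⟫ ≤ θ * ‖X‖ ^ 2 + N ^ 2 / θ := by
    intro X a j k a' j' k'
    have h1 : ⟪X, ⁅DF a j k, DF a' j' k'⁆⟫ ≤ θ * ‖X‖ ^ 2 + (‖DF a j k‖ * ‖DF a' j' k'‖) ^ 2 / θ :=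
      calc ⟪X, ⁅DF a j k, DF a' j' k'⁆⟫ ≤ |⟪X, ⁅DF a j k, DF a' j' k'⁆⟫| := le_abs_self _
        _ ≤ 2 * ‖X‖ * ‖DF a j k‖ * ‖DF a' j' k'‖ := abs_frobenius_inner_lie_le _ _ _
        _ = 2 * ‖X‖ * (‖DF a j k‖ * ‖DF a' j' k'‖) := by ring
        _ ≤ θ * ‖X‖ ^ 2 + (‖DF a j k‖ * ‖DF a' j' k'‖) ^ 2 / θ := two_mul_le_weighted' hθ _ _
    have h2 : (‖DF a j k‖ * ‖DF a' j' k'‖) ^ 2 ≤ N ^ 2 := by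
      rw [mul_pow, sq N]
      exact mul_le_mul (hDFle a j k) (hDFle a' j' k') (sq_nonneg _) hN0
    have h3 : (‖DF a j k‖ * ‖DF a' j' k'‖) ^ 2 / θ ≤ N ^ 2 / θ :=
      div_le_div_of_nonneg_right h2 hθ.le
    linarith only [h1, h3]
  -- ### the bound for one `⟨G_κ, Ψ_κ⟩`
  have hone : ∀ a w u v, ⟪G a w u v, Ψ (a, w, u, v)⟫ ≤
      (Fintype.card ι : ℝ) * (4 * c₀ * (‖G a w u v‖ ^ 2 + P) + 6 * θ * ‖G a w u v‖ ^ 2 +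
        6 * N ^ 2 / θ) := by
    intro a w u v
    have hsrc : covDeriv (A t) (Ψ₁ w u v) x (b a) = _ :=
      covDeriv_gradSource_eq b (A t) hA3 x (b u) (b v) (b w) (b a)
    simp only [hΨ]
    rw [hsrc, inner_add_right, inner_smul_right, inner_smul_right, inner_sum, inner_sum]
    -- the six `D_aΨ₁` terms
    have h6 : ∀ i, ⟪G a w u v,
        ⁅covDeriv (A t) (fun z => curvature (A t) z (b w) (b i)) x (b a),
            covDeriv (A t) (fun z => curvature (A t) z (b u) (b v)) x (b i)⁆ +
          ⁅curvature (A t) x (b w) (b i), covDeriv (A t) (fun y => covDeriv (A t)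
            (fun z => curvature (A t) z (b u) (b v)) y (b i)) x (b a)⁆ +
        (⁅covDeriv (A t) (fun y => covDeriv (A t) (fun z => curvature (A t) z (b u) (b i)) y (b w))
            x (b a), curvature (A t) x (b i) (b v)⁆ +
          ⁅covDeriv (A t) (fun z => curvature (A t) z (b u) (b i)) x (b w),
            covDeriv (A t) (fun z => curvature (A t) z (b i) (b v)) x (b a)⁆) +
        (⁅covDeriv (A t) (fun z => curvature (A t) z (b u) (b i)) x (b a),
            covDeriv (A t) (fun z => curvature (A t) z (b i) (b v)) x (b w)⁆ +
          ⁅curvature (A t) x (b u) (b i), covDeriv (A t) (fun y => covDeriv (A t)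
            (fun z => curvature (A t) z (b i) (b v)) y (b w)) x (b a)⁆)⟫ ≤
        3 * (c₀ * ((‖G a w u v‖ ^ 2 + P) / 2)) + 3 * (θ * ‖G a w u v‖ ^ 2 + N ^ 2 / θ) := by
      intro i
      rw [inner_add_right, inner_add_right, inner_add_right, inner_add_right, inner_add_right]
      have t1 := hbrD (G a w u v) a w i i u v
      have t2 := hbrF (G a w u v) (G a i u v) w i (hGle a i u v)
      have t3 := hbrF' (G a w u v) (G a w u i) i v (hGle a w u i)
      have t4 := hbrD (G a w u v) w u i a i v
      have t5 := hbrD (G a w u v) a u i w i v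
      have t6 := hbrF (G a w u v) (G a w i v) u i (hGle a w i v)
      simp only [hG, hGf, hDF, hF] at t1 t2 t3 t4 t5 t6 ⊢
      linarith only [t1, t2, t3, t4, t5, t6]
    -- the commutator term
    have hS : ∀ i, ⟪G a w u v, ⁅F a i, Gf i w u v x⁆⟫ ≤ c₀ * ((‖G a w u v‖ ^ 2 + P) / 2) :=
      fun i => hbrF (G a w u v) (G i w u v) a i (hGle i w u v)
    have hsum6 := Finset.sum_le_sum fun i (_ : i ∈ Finset.univ) => h6 i
    have hsumS := Finset.sum_le_sum fun i (_ : i ∈ Finset.univ) => hS i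
    rw [Finset.sum_const, Finset.card_univ, nsmul_eq_mul] at hsum6 hsumS
    refine (add_le_add (mul_le_mul_of_nonneg_left hsum6 zero_le_two)
      (mul_le_mul_of_nonneg_left hsumS zero_le_two)).trans (le_of_eq ?_)
    ring
  -- ### sum over `κ`
  have hsumκ : ∑ a, ∑ w, ∑ u, ∑ v, ⟪G a w u v, Ψ (a, w, u, v)⟫ ≤
      (Fintype.card ι : ℝ) * (4 * c₀ * (P + (Fintype.card ι : ℝ) ^ 4 * P) + 6 * θ * P +
        (Fintype.card ι : ℝ) ^ 4 * (6 * N ^ 2 / θ)) := by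
    have h := Finset.sum_le_sum fun a (_ : a ∈ Finset.univ) => Finset.sum_le_sum
      fun w (_ : w ∈ Finset.univ) => Finset.sum_le_sum fun u (_ : u ∈ Finset.univ) =>
      Finset.sum_le_sum fun v (_ : v ∈ Finset.univ) => hone a w u v
    refine h.trans (le_of_eq ?_)
    simp only [mul_add, Finset.sum_add_distrib, ← Finset.mul_sum, ← Finset.sum_div, hP,
      Finset.sum_const, Finset.card_univ, nsmul_eq_mul]
    ring
  -- ### conclusion
  have hsqrt : Real.sqrt (2 * ee) = Real.sqrt 2 * Real.sqrt ee := Real.sqrt_mul (by norm_num) ee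
  have hfin : 2 * ∑ a, ∑ w, ∑ u, ∑ v, ⟪G a w u v, Ψ (a, w, u, v)⟫ ≤
      (16 * Real.sqrt 2 * (Fintype.card ι : ℝ) * (1 + (Fintype.card ι : ℝ) ^ 4) * Real.sqrt ee +
          12 * (Fintype.card ι : ℝ) * θ) * P +
        12 * (Fintype.card ι : ℝ) ^ 5 / θ * N ^ 2 := by
    have h := mul_le_mul_of_nonneg_left hsumκ (by norm_num : (0 : ℝ) ≤ 2)
    have e : 2 * ((Fintype.card ι : ℝ) * (4 * c₀ * (P + (Fintype.card ι : ℝ) ^ 4 * P) +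
        6 * θ * P + (Fintype.card ι : ℝ) ^ 4 * (6 * N ^ 2 / θ))) =
        (16 * Real.sqrt 2 * (Fintype.card ι : ℝ) * (1 + (Fintype.card ι : ℝ) ^ 4) * Real.sqrt ee +
          12 * (Fintype.card ι : ℝ) * θ) * P +
        12 * (Fintype.card ι : ℝ) ^ 5 / θ * N ^ 2 := by
      rw [hc₀, hsqrt]; ring
    linarith only [h, e]
  simp only [hG, hGf, hGs, hP, hN, hee] at hfin ⊢
  linarith only [hfin]

end HessBochner

end Literature.MathematicalPhysics.QuantumLattice
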